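import Mathlib.Analysis.InnerProductSpace.Basic
import Literature.MathematicalPhysics.QuantumFieldTheory.Balaban1983to89.B4Eq19LatticeOperators
import HarnessLib

/-!
# Crux stmt-QuantumFields-19936 `UnitScaleTilt.HistoryTailL`, route crux `PoincareLipschitz.BlockLipschitzL` (stmt-QuantumFields-23533), K2 END-GAME knit
# `hRegH ⟸ hImprove ∧ [A] ∧ [T2] ∧ [C]` — K-2 «FLAT END-GAME» SIDE ROWS: the TOP-SCALE conversion «twisted energy small on `box z (2r)` ⟹ flat energy small on every
# `box x' ρ ⊆ box z (2r)`» that carries `hImprove` v1's conclusion row (twisted letters, centre `z`, scale `2r`) to the `Etop` ∕ threshold rows of the [C] door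
# (flat letters, the 27 centres `x' ∈ box z 1`, top `ρ = m^K ≤ 2r − 1`) — binder-match table (w7 g12, evidence #56) row R7 (i); the containment (ii) is taken as a
# hypothesis `box x' ρ ⊆ box z r` (px8 g5's «K-2 §3 LADDER LETTERS» supply it).

Cell `ym3-torus` (YM ladder rung R3 = continuum SU(2) Yang–Mills on T³ — a RUNG, NOT the Clay problem: not d = 4, not infinite volume, not a mass gap); width seat
`ym-ust-19936-w7` g12, helper `--supports stmt-QuantumFields-19936`; THEOREMS ONLY (0 `def`, 0 `sorry`, default heartbeats); `V` ANY real inner-product space, any `d`;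
letters of lit ✓`B4Eq19LatticeOperators` (`Zd`, `box`, `unitVec`) and of ✓`PoincareLipschitzOrbitMinTwistSlack` (`τ : Fin d → Zd d → (V ≃ₗᵢ[ℝ] V)`, defect `τ₀`).
The one-sided EXPLICIT form (factor 2, no square root) complements ✓`PoincareLipschitzOrbitMinTwistSlack.energy_le_twist` (sharp, implicit in the flat energy).
HONEST SCOPE.  Elementary inequalities; nothing of `hImprove`, `hRegH`, [C], `BlockLipschitzL`, `HistoryTailL` or a summit statement is proved here. [folklore]
-/

set_option autoImplicit false

noncomputable section

open scoped BigOperators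

namespace Summit.QuantumFields.YangMills.Theorems.PoincareLipschitzKnitFlatTopScale

open Literature.MathematicalPhysics.QuantumFieldTheory.Balaban1983to89
open B4Eq19LatticeOperators (Zd box unitVec card_box)

variable {d : ℕ} {V : Type*} [NormedAddCommGroup V] [InnerProductSpace ℝ V]

/-! ## §1 One bond -/

/-- ★ **ONE BOND, EXPLICIT**: if `‖τw − w‖ ≤ τ₀‖w‖` for all `w` and `‖a‖ = 1`, then `‖a − b‖² ≤ 2‖τa − b‖² + 2τ₀²` (triangle inequality `‖a − b‖ ≤ ‖τa − b‖ + ‖τa − a‖`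
and `(p+q)² ≤ 2p² + 2q²`). [folklore] -/
theorem normSq_sub_le_two_mul_twisted_add (τ : V ≃ₗᵢ[ℝ] V) {τ₀ : ℝ} (hτ : ∀ w, ‖τ w - w‖ ≤ τ₀ * ‖w‖) {a : V} (ha : ‖a‖ = 1) (b : V) :
    ‖a - b‖ ^ 2 ≤ 2 * ‖τ a - b‖ ^ 2 + 2 * τ₀ ^ 2 := by
  have h1 : ‖τ a - a‖ ≤ τ₀ := by simpa [ha] using hτ a
  have h2 : ‖a - b‖ ≤ ‖τ a - b‖ + ‖τ a - a‖ := by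
    have : a - b = (τ a - b) - (τ a - a) := by abel
    rw [this]
    exact norm_sub_le _ _
  have h3 : ‖a - b‖ ≤ ‖τ a - b‖ + τ₀ := le_trans h2 (by linarith)
  have h0 : 0 ≤ ‖τ a - b‖ + τ₀ := le_trans (norm_nonneg _) h3
  nlinarith [norm_nonneg (a - b), norm_nonneg (τ a - b), sq_nonneg (‖τ a - b‖ - τ₀)]

/-! ## §2 A finite set of sites: flat energy ≤ 2·(twisted energy) + 2τ₀²·(d·#Q) -/

/-- ★★ **FLAT ≤ 2·TWISTED + 2τ₀²N, EXPLICIT** (`N = d·#Q`): for twists with defect `τ₀` at the sites of `Q` and `f` unit at the far endpoints `y + e_μ` (`y ∈ Q`),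
`Σ_{y∈Q}Σ_μ ‖f(y+e_μ) − f y‖² ≤ 2·Σ_{y∈Q}Σ_μ ‖τ μ y (f(y+e_μ)) − f y‖² + 2·τ₀²·(d·#Q)`.  (The sharp two-sided form with a square root is
✓`PoincareLipschitzOrbitMinTwistSlack.energy_le_twist`; the knit's `Etop` row wants this explicit one.) [folklore] -/
theorem energy_le_two_mul_twist_add (τ : Fin d → Zd d → (V ≃ₗᵢ[ℝ] V)) {τ₀ : ℝ} (Q : Finset (Zd d))
    (hτ : ∀ y ∈ Q, ∀ (μ : Fin d) (w : V), ‖τ μ y w - w‖ ≤ τ₀ * ‖w‖) (f : Zd d → V) (hf : ∀ y ∈ Q, ∀ μ : Fin d, ‖f (y + unitVec μ)‖ = 1) :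
    ∑ y ∈ Q, ∑ μ, ‖f (y + unitVec μ) - f y‖ ^ 2 ≤
      2 * (∑ y ∈ Q, ∑ μ, ‖τ μ y (f (y + unitVec μ)) - f y‖ ^ 2) + 2 * τ₀ ^ 2 * (d * Q.card : ℝ) := by
  have hpt : ∀ y ∈ Q, ∀ μ : Fin d, ‖f (y + unitVec μ) - f y‖ ^ 2 ≤ 2 * ‖τ μ y (f (y + unitVec μ)) - f y‖ ^ 2 + 2 * τ₀ ^ 2 :=
    fun y hy μ => normSq_sub_le_two_mul_twisted_add (τ μ y) (hτ y hy μ) (hf y hy μ) (f y)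
  calc ∑ y ∈ Q, ∑ μ, ‖f (y + unitVec μ) - f y‖ ^ 2
      ≤ ∑ y ∈ Q, ∑ μ : Fin d, (2 * ‖τ μ y (f (y + unitVec μ)) - f y‖ ^ 2 + 2 * τ₀ ^ 2) :=
        Finset.sum_le_sum fun y hy => Finset.sum_le_sum fun μ _ => hpt y hy μ
    _ = 2 * (∑ y ∈ Q, ∑ μ, ‖τ μ y (f (y + unitVec μ)) - f y‖ ^ 2) + 2 * τ₀ ^ 2 * (d * Q.card : ℝ) := by
        simp only [Finset.sum_add_distrib, Finset.sum_const, Finset.card_univ, Fintype.card_fin, Finset.mul_sum]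
        ring

/-- ★ Monotonicity of the flat energy in the site set (nonnegative terms). [folklore] -/
theorem energy_mono {Q Q' : Finset (Zd d)} (h : Q ⊆ Q') (g : Zd d → Fin d → ℝ) (hg : ∀ y μ, 0 ≤ g y μ) :
    ∑ y ∈ Q, ∑ μ, g y μ ≤ ∑ y ∈ Q', ∑ μ, g y μ :=
  Finset.sum_le_sum_of_subset_of_nonneg h fun y _ _ => Finset.sum_nonneg fun μ _ => hg y μ

/-! ## §3 The top-scale row of the knit -/

/-- ★★ **THE TOP-SCALE ROW OF THE KNIT** (binder-match R7 (i)): twists with defect `τ₀` on `box z r`, `f` unit everywhere, and a sub-box `box x' ρ ⊆ box z r` (the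
ladder containment, px8 g5's «K-2 §3 LADDER LETTERS») ⟹ `E_flat(f; box x' ρ) ≤ 2·E_τ(f; box z r) + 2τ₀²·(d·#(box z r))` — so `hImprove` v1's
`E_τ(box z (2r₀))·log⁶r₀ ≤ ε₀r₀` feeds the [C] socket's `Etop` at each of the `3^d` centres `x' ∈ box z 1` with `Etop := 2ε₀r₀/log⁶r₀ + 2τ₀²·d·(4r₀+1)^d`
(lit ✓`card_box`; at `d = 3`: `6τ₀²·#Q`, vs `18τ₀²·#Q` from solving the implicit ✓`energy_le_twist`). [folklore] -/
theorem flatEnergy_subbox_le_of_twisted (τ : Fin d → Zd d → (V ≃ₗᵢ[ℝ] V)) {τ₀ : ℝ} (z : Zd d) (r : ℤ)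
    (hτ : ∀ y ∈ box z r, ∀ (μ : Fin d) (w : V), ‖τ μ y w - w‖ ≤ τ₀ * ‖w‖) (f : Zd d → V) (hf : ∀ y, ‖f y‖ = 1)
    {x' : Zd d} {ρ : ℤ} (hsub : box x' ρ ⊆ box z r) :
    ∑ y ∈ box x' ρ, ∑ μ, ‖f (y + unitVec μ) - f y‖ ^ 2 ≤
      2 * (∑ y ∈ box z r, ∑ μ, ‖τ μ y (f (y + unitVec μ)) - f y‖ ^ 2) + 2 * τ₀ ^ 2 * (d * (box z r).card : ℝ) := by
  calc ∑ y ∈ box x' ρ, ∑ μ, ‖f (y + unitVec μ) - f y‖ ^ 2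
      ≤ ∑ y ∈ box z r, ∑ μ, ‖f (y + unitVec μ) - f y‖ ^ 2 := energy_mono hsub (fun y μ => ‖f (y + unitVec μ) - f y‖ ^ 2) fun y μ => sq_nonneg _
    _ ≤ 2 * (∑ y ∈ box z r, ∑ μ, ‖τ μ y (f (y + unitVec μ)) - f y‖ ^ 2) + 2 * τ₀ ^ 2 * (d * (box z r).card : ℝ) :=
        energy_le_two_mul_twist_add τ (box z r) hτ f fun y _ μ => hf _

/-- ★ The same with the card written out: `0 ≤ r` ⟹ `#(box z r) = (2r+1)^d` (lit ✓`card_box`), so the additive term is `2τ₀²·d·(2r+1)^d`. [folklore] -/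
theorem flatEnergy_subbox_le_of_twisted' (τ : Fin d → Zd d → (V ≃ₗᵢ[ℝ] V)) {τ₀ : ℝ} (z : Zd d) {r : ℤ} (hr : 0 ≤ r)
    (hτ : ∀ y ∈ box z r, ∀ (μ : Fin d) (w : V), ‖τ μ y w - w‖ ≤ τ₀ * ‖w‖) (f : Zd d → V) (hf : ∀ y, ‖f y‖ = 1)
    {x' : Zd d} {ρ : ℤ} (hsub : box x' ρ ⊆ box z r) :
    ∑ y ∈ box x' ρ, ∑ μ, ‖f (y + unitVec μ) - f y‖ ^ 2 ≤
      2 * (∑ y ∈ box z r, ∑ μ, ‖τ μ y (f (y + unitVec μ)) - f y‖ ^ 2) + 2 * τ₀ ^ 2 * (d * ((2 * r + 1 : ℤ) : ℝ) ^ d) := by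
  have h := flatEnergy_subbox_le_of_twisted τ z r hτ f hf hsub
  rwa [card_box z hr] at h

end Summit.QuantumFields.YangMills.Theorems.PoincareLipschitzKnitFlatTopScale

end
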